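import Literature.NumberTheory.Automorphic.AsaiSignContProofs
import Literature.NumberTheory.Automorphic.PairLFunctionMeromorphicContinuation
import Literature.NumberTheory.Automorphic.PairLFunctionBaseChangeProofs
import Literature.NumberTheory.Automorphic.LanglandsTetrahedralProofs
import HarnessLib

/-!
# Mok's Asai-pole dichotomy in continuation form: the Rankin–Selberg input from the `L²`
# facts of Jacquet–Shalika and Mœglin–Waldspurger, and partial functions for arbitrary `S`

Topic `NumberTheory/Automorphic`; namespace `Literature.NumberTheory.Automorphic`. Proof file
(theorems only: no definition, no named fact, no instance), second sibling of `AsaiSignCont`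
(the named fact `Mok2014_partialAsaiL_continuation_pole_dichotomy`), continuing
`AsaiSignContProofs` (`Mok2014_partialAsaiL_continuation_pole_dichotomy_of_holomorphy`: the fact
from holomorphy `hHol` and a Rankin–Selberg hypothesis `hRS` for the pair `(Π, Π^c)` at EVERY Asai
datum).

## What is proved

The Rankin–Selberg input of the printed proof ("`L(s, φ^N × (φ^N)^c) = L(s, φ^N × (φ^N)^∨)`,
hence has a simple pole at `s = 1` by [JPSS]", Mok §2.5; Grbac–Shahidi 2015, p. 206) is derived
here, for all SUFFICIENTLY LARGE Asai data of a conjugate self-dual cuspidal `Π`, from the tree's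
`L²` named facts

* `MoeglinWaldspurger1989_partialPairL_of_eq_conj` (Mœglin–Waldspurger 1989, Appendice,
  Cor. (ii): `s (s - 1) L^S(s, π ⊗ π̄)` entire), and
* `JacquetShalika1981_partialPairL_pole_of_eq_conj` (Arthur–Clozel, Ch. 3, (2.3): the simple pole
  of `L^S(s, π ⊗ π̄)` at `s = 1` along `Re s → 1⁺`),

applied to the `L²` constituent `Π₀` carrying the Satake parameters of `Π` up to the twist `q_w^z`
(`CuspidalAutomorphicRepData.exists_satake_eq_cpow_mul_L2_holds`, Borel–Jacquet 5.7): off a finite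
set of places of `E` (those outside the dictionary with `Π₀`, and those where the almost-everywhere
conjugate self-duality `t_{Π, c w} = t_{Π, w}⁻¹` fails) the unramified pair factor of `(A, A ∘ c)` is
`det(1 - t_w ⊗ t_{c w} T) = det(1 - q^z t_{Π₀,w} ⊗ q^{-z} t_{Π₀,w}⁻¹ T) = det(1 - t_{Π₀,w} ⊗ t̄_{Π₀,w} T)`
(`t_{Π₀,w}⁻¹ = t̄_{Π₀,w}` for the unitary `Π₀`, `IsSatakeFamilyOf.map_inv_eq_map_conj`), i.e. the
pair factor of `(Π₀, Π̄₀)` — so `L^{S_E}(s, A ⊗ A^c)` IS the partial Rankin–Selberg function of the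
conjugate pair of `L²` representations, with no exceptional factor, as soon as `S` contains that
finite set (`exists_largeSet_pairL_of_L2`).

For an ARBITRARY Asai datum `(S, A)` the dichotomy is then read off the enlarged datum
`(S ∪ S⋆, A)` and transported DOWN to `S`: the continuation `G''` of `(s - 1) L^{S ∪ S⋆}` equals
`G · ∏_{v ∈ S⋆ ∖ S} det(1 - As^η(t_v) q_v^{-s})` on `{1/2 < Re s}` for the continuation `G` of
`(s - 1) L^S` (uniqueness of continuation, `continuation_eq_mul_prod`), so a pole goes down for free
(`G(1) ≠ 0`, `apply_one_ne_zero_of_subset`) while holomorphy-and-non-vanishing at `1` goes down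
exactly when the finitely many removed unramified factors have no pole at `s = 1`
(`exists_continuation_of_subset_of_ne_zero`): the hypothesis `hNV` below —
`det(1 - As^θ(t_v) q_v^{-1}) ≠ 0` at the unramified `v ∉ S` — which in print is Jacquet–Shalika's
bound `|α| < q_w^{1/2}` on the Satake parameters of the unitary generic `Π_w` (Jacquet–Shalika
1981 I, Cor. 2.5: the eigenvalues `±α_i`, `α_i α_j` (inert, `q_w = q_v²`) and `α_i β_j` (split) of
`As^θ(t_v)` then have absolute value `< q_v`), in the tree the LOCAL named fact
`JacquetShalika1981_norm_lt_sqrt_of_isGeneric` together with the local–global dictionary; it is kept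
as a hypothesis here.  Result:
`Mok2014_partialAsaiL_continuation_pole_dichotomy_of_holomorphy_of_L2` — **the named fact follows
from `hHol` (Grbac–Shahidi, Thm. 4.3 (2)(a), holomorphy on `{1/2 < Re s}`), the two `L²` named facts,
and `hNV`.**

What this does NOT give: `hHol` (Langlands–Shahidi theory on `U(n, n)`), the two `L²` facts
(Rankin–Selberg theory), `hNV` (Jacquet–Shalika's local bound for all unramified components).

## References

* C. P. Mok, *Endoscopic classification of representations of quasi-split unitary groups*,
  Mem. Amer. Math. Soc. 235 (2015), no. 1108, §2.5 (paragraph before Thm. 2.5.4), Thm. 2.5.4 (a).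
  [Mok2014]
* N. Grbac, F. Shahidi, *Endoscopic transfer for unitary groups and holomorphy of Asai
  `L`-functions*, Pacific J. Math. 276 (2015), Thm. 4.3 and its proof, pp. 204–206. [GrbacShahidi2015]
* C. Mœglin, J.-L. Waldspurger, *Le spectre résiduel de GL(n)*, Ann. Sci. ÉNS 22 (1989),
  Appendice, Corollaire. [MoeglinWaldspurger1989]
* J. Arthur, L. Clozel, *Simple algebras, base change, and the advanced theory of the trace formula*,
  Ann. of Math. Stud. 120 (1989), Ch. 3 §2, (2.3). [ArthurClozelAMS120]
* H. Jacquet, J. A. Shalika, *On Euler products and the classification of automorphic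
  representations I*, Amer. J. Math. 103 (1981), Cor. 2.5. [JacquetShalikaAJM1981]
* A. Borel, H. Jacquet, *Automorphic forms and automorphic representations*, Corvallis 1979, 5.7.
  [BorelJacquetCorvallis1979]
-/

noncomputable section

open scoped Topology Classical
open NumberField IsDedekindDomain Filter Polynomial MeasureTheory

namespace Literature.NumberTheory.Automorphic

/-! ### Analysis on `{1/2 < Re s}`: uniqueness of continuation, derivatives at `s = 1` -/

section Analysis

/-- **Identity theorem from a right half-plane down to `{1/2 < Re s}`.** Two functions holomorphic
on the convex open half-plane `{1/2 < Re s}` which agree on `{σ < Re s}` (`σ ≥ 1`) agree on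
`{1/2 < Re s}`. [folklore] -/
theorem eqOn_half_lt_re_of_eq_on_lt_re {Φ Ψ : ℂ → ℂ} {σ : ℝ} (hσ : 1 ≤ σ)
    (hΦ : DifferentiableOn ℂ Φ {s : ℂ | 1 / 2 < s.re}) (hΨ : DifferentiableOn ℂ Ψ {s : ℂ | 1 / 2 < s.re})
    (h : ∀ s : ℂ, σ < s.re → Φ s = Ψ s) : Set.EqOn Φ Ψ {s : ℂ | 1 / 2 < s.re} := by
  have hU : IsOpen {s : ℂ | 1 / 2 < s.re} := isOpen_lt continuous_const Complex.continuous_re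
  have hΦa : AnalyticOnNhd ℂ Φ {s : ℂ | 1 / 2 < s.re} := hΦ.analyticOnNhd hU
  have hΨa : AnalyticOnNhd ℂ Ψ {s : ℂ | 1 / 2 < s.re} := hΨ.analyticOnNhd hU
  set z₀ : ℂ := ((σ + 1 : ℝ) : ℂ) with hz₀
  have hz₀re : z₀.re = σ + 1 := by simp [hz₀]
  have hz₀U : z₀ ∈ {s : ℂ | 1 / 2 < s.re} := by
    simp only [Set.mem_setOf_eq, hz₀re]
    linarith
  have hev : Φ =ᶠ[𝓝 z₀] Ψ := by
    have hmem : {s : ℂ | σ < s.re} ∈ 𝓝 z₀ :=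
      (isOpen_lt continuous_const Complex.continuous_re).mem_nhds (by
        simp only [Set.mem_setOf_eq, hz₀re]
        linarith)
    exact Filter.eventually_of_mem hmem fun s hs => h s hs
  exact hΦa.eqOn_of_preconnected_of_eventuallyEq hΨa (convex_halfSpace_re_gt (1 / 2)).isPreconnected
    hz₀U hev

/-- `d/ds [(s - 1) H(s)]` at `s = 1` is `H(1)` (for `H` differentiable at `1`). [folklore] -/
theorem deriv_sub_one_mul_apply_one {H : ℂ → ℂ} (hH : DifferentiableAt ℂ H 1) :
    deriv (fun s => (s - 1) * H s) 1 = H 1 := by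
  have h1 : DifferentiableAt ℂ (fun s : ℂ => s - 1) 1 := differentiableAt_id.sub_const 1
  have key := deriv_fun_mul h1 hH
  rw [key, deriv_sub_const, deriv_id'']
  simp

/-- `d/ds [G(s) Q(s)]` at a zero `s = 1` of `G` is `G'(1) Q(1)`. [folklore] -/
theorem deriv_mul_apply_one_of_apply_eq_zero {G Q : ℂ → ℂ} (hG : DifferentiableAt ℂ G 1)
    (hQ : DifferentiableAt ℂ Q 1) (hG1 : G 1 = 0) :
    deriv (fun s => G s * Q s) 1 = deriv G 1 * Q 1 := by
  rw [deriv_fun_mul hG hQ, hG1, zero_mul, add_zero]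

end Analysis

/-! ### Partial Asai functions of one family for nested sets of places `S ⊆ S''` -/

section Family

variable {F E : Type} [Field F] [NumberField F] [Field E] [Algebra F E]

/-- **Far to the right, `L^{S''} = (∏_{v ∈ S'' ∖ S} det(1 - As^η(t_v) q_v^{-s})) · L^S`**: for
`S ⊆ S''` with `S'' ∖ S` finite and the product over `v ∉ S''` multipliable on `{σm < Re s}`, the
identity holds on some right half-plane (beyond the non-vanishing thresholds of the finitely many
removed factors, `exists_forall_eval_asaiLocalPolynomial_ne_zero`). [folklore] -/
theorem exists_forall_partialAsaiL_eq_prod_mul {S S'' : Set (HeightOneSpectrum (𝓞 F))}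
    (hSS'' : S ⊆ S'') (hfin : (S'' \ S).Finite) (c : E ≃ₐ[F] E) (A : SatakeFamily E) (η : ℤˣ)
    {σm : ℝ}
    (hmul : ∀ s : ℂ, σm < s.re →
      Multipliable fun v : {v : HeightOneSpectrum (𝓞 F) // v ∉ S''} =>
        ((asaiLocalPolynomial c A η (placeAbove E v.1)).eval ((v.1.residueCard : ℂ) ^ (-s)))⁻¹) :
    ∃ σ' : ℝ, σm ≤ σ' ∧ ∀ s : ℂ, σ' < s.re →
      partialAsaiL S'' c A η s =
        (∏ v ∈ hfin.toFinset,
            (asaiLocalPolynomial c A η (placeAbove E v)).eval ((v.residueCard : ℂ) ^ (-s))) *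
          partialAsaiL S c A η s := by
  classical
  choose σv hσv using fun v : HeightOneSpectrum (𝓞 F) =>
    exists_forall_eval_asaiLocalPolynomial_ne_zero c A (placeAbove E v) v.one_lt_residueCard
  set σ₂ : ℝ := ∑ v ∈ hfin.toFinset, |σv v| with hσ₂
  have hσ₂v : ∀ v ∈ hfin.toFinset, σv v ≤ σ₂ := fun v hv =>
    (le_abs_self _).trans (Finset.single_le_sum (fun u _ => abs_nonneg (σv u)) hv)
  refine ⟨max σm σ₂, le_max_left _ _, fun s hs => ?_⟩
  have hsm : σm < s.re := lt_of_le_of_lt (le_max_left _ _) hs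
  have hs₂ : σ₂ < s.re := lt_of_le_of_lt (le_max_right _ _) hs
  exact partialAsaiL_eq_prod_mul_partialAsaiL_of_ne_zero hSS'' hfin c A η (hmul s hsm)
    fun v hv => hσv v η s (lt_of_le_of_lt (hσ₂v v hv) hs₂)

/-- **Uniqueness of continuation along `S ⊆ S''`.** If `G` continues `(s - 1) L^S(s, A, As^η)` and
`G''` continues `(s - 1) L^{S''}(s, A, As^η)` to `{1/2 < Re s}` (`S ⊆ S''`, `S'' ∖ S` finite, the
`S''`-product multipliable far to the right), then `G'' = G · ∏_{v ∈ S'' ∖ S} det(1 - As^η(t_v) q_v^{-s})`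
on all of `{1/2 < Re s}`: both sides are holomorphic there (the removed factors are entire,
`differentiable_eval_asaiLocalPolynomial_cpow`) and agree far to the right. [folklore] -/
theorem continuation_eq_mul_prod {S S'' : Set (HeightOneSpectrum (𝓞 F))} (hSS'' : S ⊆ S'')
    (hfin : (S'' \ S).Finite) (c : E ≃ₐ[F] E) (A : SatakeFamily E) (η : ℤˣ) {σm : ℝ}
    (hmul : ∀ s : ℂ, σm < s.re →
      Multipliable fun v : {v : HeightOneSpectrum (𝓞 F) // v ∉ S''} =>
        ((asaiLocalPolynomial c A η (placeAbove E v.1)).eval ((v.1.residueCard : ℂ) ^ (-s)))⁻¹)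
    {σ₀ : ℝ} (hσ₀ : 1 ≤ σ₀) {G : ℂ → ℂ} (hG : DifferentiableOn ℂ G {s : ℂ | 1 / 2 < s.re})
    (hGL : ∀ s : ℂ, σ₀ < s.re → G s = (s - 1) * partialAsaiL S c A η s)
    {σ₀'' : ℝ} {G'' : ℂ → ℂ} (hG'' : DifferentiableOn ℂ G'' {s : ℂ | 1 / 2 < s.re})
    (hG''L : ∀ s : ℂ, σ₀'' < s.re → G'' s = (s - 1) * partialAsaiL S'' c A η s) :
    Set.EqOn G'' (fun s => G s *
      ∏ v ∈ hfin.toFinset,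
        (asaiLocalPolynomial c A η (placeAbove E v)).eval ((v.residueCard : ℂ) ^ (-s)))
      {s : ℂ | 1 / 2 < s.re} := by
  obtain ⟨σ', -, hσ'⟩ := exists_forall_partialAsaiL_eq_prod_mul hSS'' hfin c A η hmul
  have hQ : DifferentiableOn ℂ (fun s => G s *
      ∏ v ∈ hfin.toFinset,
        (asaiLocalPolynomial c A η (placeAbove E v)).eval ((v.residueCard : ℂ) ^ (-s)))
      {s : ℂ | 1 / 2 < s.re} :=
    hG.mul (DifferentiableOn.fun_finsetProd fun v _ =>
      (differentiable_eval_asaiLocalPolynomial_cpow c A η (placeAbove E v)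
        (zero_lt_one.trans v.one_lt_residueCard)).differentiableOn)
  have hmax : 1 ≤ max (max σ₀ σ₀'') σ' := hσ₀.trans ((le_max_left _ _).trans (le_max_left _ _))
  refine eqOn_half_lt_re_of_eq_on_lt_re hmax hG'' hQ fun s hs => ?_
  have hs₀ : σ₀ < s.re := lt_of_le_of_lt ((le_max_left _ _).trans (le_max_left _ _)) hs
  have hs₀'' : σ₀'' < s.re := lt_of_le_of_lt ((le_max_right _ _).trans (le_max_left _ _)) hs
  have hs' : σ' < s.re := lt_of_le_of_lt (le_max_right _ _) hs
  show G'' s = G s * _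
  rw [hG''L s hs₀'', hσ' s hs', hGL s hs₀]
  ring

/-- **A continued simple pole goes down from `S''` to `S ⊆ S''`** (same family, same sign): with
`G`, `G''` as in `continuation_eq_mul_prod`, `G''(1) = G(1) · ∏_v det(1 - As^η(t_v) q_v^{-1})`, so
`G''(1) ≠ 0` forces `G(1) ≠ 0`. [folklore] -/
theorem apply_one_ne_zero_of_subset {S S'' : Set (HeightOneSpectrum (𝓞 F))} (hSS'' : S ⊆ S'')
    (hfin : (S'' \ S).Finite) (c : E ≃ₐ[F] E) (A : SatakeFamily E) (η : ℤˣ) {σm : ℝ}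
    (hmul : ∀ s : ℂ, σm < s.re →
      Multipliable fun v : {v : HeightOneSpectrum (𝓞 F) // v ∉ S''} =>
        ((asaiLocalPolynomial c A η (placeAbove E v.1)).eval ((v.1.residueCard : ℂ) ^ (-s)))⁻¹)
    {σ₀ : ℝ} (hσ₀ : 1 ≤ σ₀) {G : ℂ → ℂ} (hG : DifferentiableOn ℂ G {s : ℂ | 1 / 2 < s.re})
    (hGL : ∀ s : ℂ, σ₀ < s.re → G s = (s - 1) * partialAsaiL S c A η s)
    {σ₀'' : ℝ} {G'' : ℂ → ℂ} (hG'' : DifferentiableOn ℂ G'' {s : ℂ | 1 / 2 < s.re})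
    (hG''L : ∀ s : ℂ, σ₀'' < s.re → G'' s = (s - 1) * partialAsaiL S'' c A η s) (hG''1 : G'' 1 ≠ 0) :
    G 1 ≠ 0 := by
  have h1 : (1 : ℂ) ∈ {s : ℂ | 1 / 2 < s.re} := by
    simp only [Set.mem_setOf_eq, Complex.one_re]
    norm_num
  have key := continuation_eq_mul_prod hSS'' hfin c A η hmul hσ₀ hG hGL hG'' hG''L h1
  intro hG1
  apply hG''1
  rw [key]
  show G 1 * _ = 0
  rw [hG1, zero_mul]

/-- **Holomorphy and non-vanishing at `1` go down from `S''` to `S ⊆ S''` when the removed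
unramified factors have no pole at `s = 1`.** Let `G` continue `(s - 1) L^S(s, A, As^η)` and `H''`
continue `L^{S''}(s, A, As^η)` to `{1/2 < Re s}` with `H''(1) ≠ 0`, and assume
`det(1 - As^η(t_v) q_v^{-1}) ≠ 0` for `v ∈ S'' ∖ S`. Then `(s - 1) H'' = G · Q` on `{1/2 < Re s}`
(`Q` the product of the removed factors, `continuation_eq_mul_prod`), so `G(1) Q(1) = 0` and
`G(1) = 0`; hence `dslope G 1` continues `L^S` holomorphically to `{1/2 < Re s}`, and its value
`G'(1)` at `1` satisfies `G'(1) Q(1) = H''(1) ≠ 0` (differentiate `G Q = (s - 1) H''` at `1`).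
[folklore] -/
theorem exists_continuation_of_subset_of_ne_zero {S S'' : Set (HeightOneSpectrum (𝓞 F))}
    (hSS'' : S ⊆ S'') (hfin : (S'' \ S).Finite) (c : E ≃ₐ[F] E) (A : SatakeFamily E) (η : ℤˣ)
    {σm : ℝ}
    (hmul : ∀ s : ℂ, σm < s.re →
      Multipliable fun v : {v : HeightOneSpectrum (𝓞 F) // v ∉ S''} =>
        ((asaiLocalPolynomial c A η (placeAbove E v.1)).eval ((v.1.residueCard : ℂ) ^ (-s)))⁻¹)
    {σ₀ : ℝ} (hσ₀ : 1 ≤ σ₀) {G : ℂ → ℂ} (hG : DifferentiableOn ℂ G {s : ℂ | 1 / 2 < s.re})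
    (hGL : ∀ s : ℂ, σ₀ < s.re → G s = (s - 1) * partialAsaiL S c A η s)
    {σ₁'' : ℝ} {H'' : ℂ → ℂ} (hH'' : DifferentiableOn ℂ H'' {s : ℂ | 1 / 2 < s.re})
    (hH''L : ∀ s : ℂ, σ₁'' < s.re → H'' s = partialAsaiL S'' c A η s) (hH''1 : H'' 1 ≠ 0)
    (hNV : ∀ v ∈ hfin.toFinset,
      (asaiLocalPolynomial c A η (placeAbove E v)).eval ((v.residueCard : ℂ) ^ (-(1 : ℂ))) ≠ 0) :
    ∃ H : ℂ → ℂ, DifferentiableOn ℂ H {s : ℂ | 1 / 2 < s.re} ∧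
      (∀ s : ℂ, σ₀ < s.re → H s = partialAsaiL S c A η s) ∧ H 1 ≠ 0 := by
  have h1 : (1 : ℂ) ∈ {s : ℂ | 1 / 2 < s.re} := by
    simp only [Set.mem_setOf_eq, Complex.one_re]
    norm_num
  have hU1 : {s : ℂ | 1 / 2 < s.re} ∈ 𝓝 (1 : ℂ) := half_lt_re_mem_nhds_one
  -- `K = (s - 1) H''` continues `(s - 1) L^{S''}`
  set K : ℂ → ℂ := fun s => (s - 1) * H'' s with hK
  have hKd : DifferentiableOn ℂ K {s : ℂ | 1 / 2 < s.re} := (differentiableOn_id.sub_const 1).mul hH''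
  have hKL : ∀ s : ℂ, σ₁'' < s.re → K s = (s - 1) * partialAsaiL S'' c A η s := fun s hs => by
    simp only [hK, hH''L s hs]
  -- the removed factors
  set Q : ℂ → ℂ := fun s => ∏ v ∈ hfin.toFinset,
    (asaiLocalPolynomial c A η (placeAbove E v)).eval ((v.residueCard : ℂ) ^ (-s)) with hQ
  have hQd : Differentiable ℂ Q := Differentiable.fun_finsetProd fun v _ =>
    differentiable_eval_asaiLocalPolynomial_cpow c A η (placeAbove E v)
      (zero_lt_one.trans v.one_lt_residueCard)
  have hQ1 : Q 1 ≠ 0 := by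
    simp only [hQ]
    exact Finset.prod_ne_zero_iff.mpr hNV
  -- `K = G Q` on the half-plane
  have key : Set.EqOn K (fun s => G s * Q s) {s : ℂ | 1 / 2 < s.re} :=
    continuation_eq_mul_prod hSS'' hfin c A η hmul hσ₀ hG hGL hKd hKL
  -- `G(1) = 0`
  have hG1 : G 1 = 0 := by
    have h := key h1
    simp only [hK, sub_self, zero_mul] at h
    rcases mul_eq_zero.mp h.symm with h0 | h0
    · exact h0
    · exact absurd h0 hQ1
  -- derivatives at `1`: `K'(1) = H''(1)` and `(G Q)'(1) = G'(1) Q(1)`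
  have hGat : DifferentiableAt ℂ G 1 := hG.differentiableAt hU1
  have hH''at : DifferentiableAt ℂ H'' 1 := hH''.differentiableAt hU1
  have hev : K =ᶠ[𝓝 1] fun s => G s * Q s :=
    Filter.eventually_of_mem hU1 fun s hs => key hs
  have hderiv : deriv G 1 * Q 1 = H'' 1 := by
    rw [← deriv_mul_apply_one_of_apply_eq_zero hGat (hQd 1) hG1, ← hev.deriv_eq]
    exact deriv_sub_one_mul_apply_one hH''at
  have hd : deriv G 1 ≠ 0 := fun h => hH''1 (by rw [← hderiv, h, zero_mul])
  exact ⟨dslope G 1, (Complex.differentiableOn_dslope hU1).mpr hG,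
    fun s hs => dslope_one_eq_of_eq_sub_one_mul hσ₀ hG1 hGL hs, by rwa [dslope_same]⟩

end Family

/-! ### The Rankin–Selberg input at large data, from the `L²` facts -/

section RankinSelberg

open AdelicGroupData

variable {F E : Type} [Field F] [NumberField F] [Field E] [NumberField E] [Algebra F E]
  {N : ℕ} {hcpt : isCompact_glFiniteIntegralLevel N E}

/-- The places of `E` above a finite set of places of `F` form a finite set (finitely many primes
above each prime, Mathlib `IsDedekindDomain.primesOver_finite`). [folklore] -/
private theorem finite_setOf_under_mem_aux {S : Set (HeightOneSpectrum (𝓞 F))} (hS : S.Finite) :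
    {w : HeightOneSpectrum (𝓞 E) | w.under (𝓞 F) ∈ S}.Finite := by
  have h : {w : HeightOneSpectrum (𝓞 E) | w.under (𝓞 F) ∈ S} =
      ⋃ v ∈ S, {w : HeightOneSpectrum (𝓞 E) | w.under (𝓞 F) = v} := by
    ext w
    simp
  rw [h]
  refine hS.biUnion fun v _ => ?_
  have hfin : (HeightOneSpectrum.asIdeal ⁻¹' v.asIdeal.primesOver (𝓞 E) :
      Set (HeightOneSpectrum (𝓞 E))).Finite :=
    (IsDedekindDomain.primesOver_finite v.asIdeal (𝓞 E)).preimage fun _ _ _ _ h =>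
      HeightOneSpectrum.ext h
  refine hfin.subset fun w hw => ?_
  simp only [Set.mem_setOf_eq] at hw
  subst hw
  exact ⟨w.isPrime, ⟨rfl⟩⟩

/-- **`L^{S_E}(s, Π × Π^c)` is the partial Rankin–Selberg function of an `L²` conjugate pair, for
`S` large** — the Rankin–Selberg input `hRS` of
`Mok2014_partialAsaiL_continuation_pole_dichotomy_of_holomorphy` at all sufficiently large Asai
data, from the `L²` named facts.  For `[E : F] = 2` (not needed), a conjugate self-dual cuspidal
`Π` on `GL_N(𝔸_E)`, `N ≥ 1` (`IsConjSelfDualAE`), granted Mœglin–Waldspurger's Cor. (ii)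
(`hMW`) and Jacquet–Shalika's (2.3) (`hJS`) for `L²_cusp(GL_N(𝔸_E))` (every automorphic measure):
there is a finite set `S⋆` of places of `F` such that for every Asai datum `(S, A)` with `S⋆ ⊆ S`
the raw product `R(s) = L^{S_E}(s, A ⊗ A^c)` off the places above `S` is multipliable on a right
half-plane, holomorphic on `{1 < Re s}`, and `(s - 1) R(s) → r ≠ 0` as `s → 1`, `Re s > 1`.
Proof: `t_{Π,w} = q_w^z t_{Π₀,w}` off `S₁` for an `L²` cuspidal `Π₀` (Borel–Jacquet 5.7,
`exists_satake_eq_cpow_mul_L2_holds`), `t_{Π,cw} = t_{Π,w}⁻¹` off the finite failure set of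
`IsConjSelfDualAE`, `t_{Π₀,w}⁻¹ = t̄_{Π₀,w}` (`IsSatakeFamilyOf.map_inv_eq_map_conj`); with `S⋆` the
places below these exceptions, every factor of `R` is the pair factor of `(Π₀, Π̄₀)`
(`satakePairPolynomial_map_mul_map_mul`, `q^z q^{-z} = 1`), so `R = L^{S_E}(s, Π₀ ⊗ Π̄₀)`, to which
`hMW` (holomorphy off `{0, 1}`), `hJS` (the pole) and `multipliable_partialPairL_of_lt_re`
(`Re s > 2N² + 3`) apply. [cite: Mok2014, §2.5 before Thm. 2.5.4]
[cite: ArthurClozelAMS120, Ch. 3 §2 (2.3)] [cite: MoeglinWaldspurger1989, Appendice, Corollaire (ii)]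
[cite: BorelJacquetCorvallis1979, 5.7] -/
theorem CuspidalAutomorphicRepData.exists_largeSet_pairL_of_L2
    (hMW : ∀ (μ : Measure (gl N E).automorphicQuotient) [(gl N E).IsAutomorphicMeasure μ],
      MoeglinWaldspurger1989_partialPairL_of_eq_conj (n := N) (K := E) (μ := μ))
    (hJS : ∀ (μ : Measure (gl N E).automorphicQuotient) [(gl N E).IsAutomorphicMeasure μ],
      JacquetShalika1981_partialPairL_pole_of_eq_conj (n := N) (K := E) (μ := μ))
    {c : E ≃ₐ[F] E} (hN : 0 < N) (π : CuspidalAutomorphicRepData N E hcpt)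
    (hπ : π.1.IsConjSelfDualAE c) :
    ∃ Sstar : Set (HeightOneSpectrum (𝓞 F)), Sstar.Finite ∧
      ∀ (S : Set (HeightOneSpectrum (𝓞 F))) (A : SatakeFamily E), Sstar ⊆ S →
        π.1.IsAsaiDatum c S A →
        (∃ σR : ℝ, ∀ s : ℂ, σR < s.re →
          Multipliable fun w : {w : HeightOneSpectrum (𝓞 E) // w.under (𝓞 F) ∉ S} =>
            ((satakePairPolynomial (A w.1) (A (c • w.1))).eval
              ((w.1.residueCard : ℂ) ^ (-s)))⁻¹) ∧
        DifferentiableOn ℂ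
          (partialPairL {w : HeightOneSpectrum (𝓞 E) | w.under (𝓞 F) ∈ S} A (fun w => A (c • w)))
          {s : ℂ | 1 < s.re} ∧
        ∃ r : ℂ, r ≠ 0 ∧
          Tendsto (fun s => (s - 1) *
              partialPairL {w : HeightOneSpectrum (𝓞 E) | w.under (𝓞 F) ∈ S} A
                (fun w => A (c • w)) s)
            (𝓝[{s : ℂ | 1 < s.re}] 1) (𝓝 r) := by
  classical
  haveI : NeZero N := ⟨hN.ne'⟩
  obtain ⟨μ, hμ⟩ := AdelicGroupData.exists_isAutomorphicMeasure_gl_holds (n := N) (K := E)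
  haveI := hμ
  obtain ⟨z, P, S₁, αP, hS₁, hαP, hdict⟩ :=
    CuspidalAutomorphicRepData.exists_satake_eq_cpow_mul_L2_holds μ π
  -- the finite failure set of the almost-everywhere conjugate self-duality
  have hπ' : ∀ᶠ w : HeightOneSpectrum (𝓞 E) in cofinite, ∀ α β : Multiset ℂ,
      π.1.HasSatakeParamAt w α → π.1.HasSatakeParamAt (c • w) β → β = α.map (·⁻¹) := hπ
  set B : Set (HeightOneSpectrum (𝓞 E)) := {w | ¬ ∀ α β : Multiset ℂ,
      π.1.HasSatakeParamAt w α → π.1.HasSatakeParamAt (c • w) β → β = α.map (·⁻¹)} with hB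
  have hBfin : B.Finite := Filter.eventually_cofinite.mp hπ'
  refine ⟨(fun w : HeightOneSpectrum (𝓞 E) => w.under (𝓞 F)) '' (S₁ ∪ B), (hS₁.union hBfin).image _,
    fun S A hSstar hSA => ?_⟩
  -- abbreviations and bookkeeping above the complement of `S`
  set SE : Set (HeightOneSpectrum (𝓞 E)) := {w | w.under (𝓞 F) ∈ S} with hSE
  have hSEfin : SE.Finite := finite_setOf_under_mem_aux hSA.finite
  have hS₁SE : S₁ ⊆ SE := fun w hw => hSstar ⟨w, Or.inl hw, rfl⟩
  have hnotS₁ : ∀ w : HeightOneSpectrum (𝓞 E), w.under (𝓞 F) ∉ S → w ∉ S₁ :=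
    fun w hw h => hw (hSstar ⟨w, Or.inl h, rfl⟩)
  have hgood : ∀ w : HeightOneSpectrum (𝓞 E), w.under (𝓞 F) ∉ S → ∀ α β : Multiset ℂ,
      π.1.HasSatakeParamAt w α → π.1.HasSatakeParamAt (c • w) β → β = α.map (·⁻¹) := by
    intro w hw
    by_contra h
    exact hw (hSstar ⟨w, Or.inr h, rfl⟩)
  have hα' : IsSatakeFamilyOf P SE αP := hαP.mono hS₁SE
  have hβ' : IsSatakeFamilyOf P.conj SE fun w => (αP w).map (starRingEnd ℂ) := hα'.conj
  -- the pair factor of `(A, A ∘ c)` at `w ∉ S_E` is the pair factor of `(Π₀, Π̄₀)`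
  have key : ∀ w : HeightOneSpectrum (𝓞 E), w.under (𝓞 F) ∉ S →
      satakePairPolynomial (A w) (A (c • w)) =
        satakePairPolynomial (αP w) ((αP w).map (starRingEnd ℂ)) := by
    intro w hw
    have hwS₁ : w ∉ S₁ := hnotS₁ w hw
    have hcw : (c • w).under (𝓞 F) ∉ S := by rwa [HeightOneSpectrum.under_algEquiv_smul]
    have hAw : A w = (αP w).map (((w.residueCard : ℂ) ^ z) * ·) :=
      (hdict w hwS₁ (A w)).mp (hSA.hasSatakeParamAt hw)
    have hAcw : A (c • w) = (A w).map (·⁻¹) :=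
      hgood w hw (A w) (A (c • w)) (hSA.hasSatakeParamAt hw) (hSA.hasSatakeParamAt hcw)
    have hinv : (αP w).map (·⁻¹) = (αP w).map (starRingEnd ℂ) := hαP.map_inv_eq_map_conj hwS₁
    have hq0 : (w.residueCard : ℂ) ≠ 0 := by
      exact_mod_cast (zero_lt_one.trans w.one_lt_residueCard).ne'
    have hqz : (w.residueCard : ℂ) ^ z ≠ 0 := fun h =>
      hq0 ((Complex.cpow_eq_zero_iff _ _).mp h).1
    have hAcw' : A (c • w) =
        ((αP w).map (starRingEnd ℂ)).map (((w.residueCard : ℂ) ^ (-z)) * ·) := by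
      rw [hAcw, hAw, ← hinv, Multiset.map_map, Multiset.map_map]
      refine Multiset.map_congr rfl fun x _ => ?_
      show ((w.residueCard : ℂ) ^ z * x)⁻¹ = (w.residueCard : ℂ) ^ (-z) * x⁻¹
      rw [mul_inv, Complex.cpow_neg]
    rw [hAw, hAcw']
    exact satakePairPolynomial_map_mul_map_mul (by rw [Complex.cpow_neg, mul_inv_cancel₀ hqz]) _ _
  -- hence `R = L^{S_E}(s, Π₀ ⊗ Π̄₀)` as functions
  have hR : partialPairL SE A (fun w => A (c • w)) =
      partialPairL SE αP (fun w => (αP w).map (starRingEnd ℂ)) := by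
    funext s
    unfold partialPairL
    exact tprod_congr fun w => by rw [key w.1 w.2]
  refine ⟨⟨2 * (N : ℝ) ^ 2 + 3, fun s hs => ?_⟩, ?_, ?_⟩
  · -- multipliability far to the right
    have hs' : (N : ℝ) ^ 2 + (N : ℝ) ^ 2 + 3 < s.re := by linarith
    exact (multipliable_partialPairL_of_lt_re hα' hβ' hs').congr fun w => by rw [key w.1 w.2]
  · -- holomorphy on `{1 < Re s}` (Mœglin–Waldspurger)
    obtain ⟨g, hg, hgL⟩ := differentiableOn_partialPairL_of_eq_conj (hMW μ) hN P P.conj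
      (P.conj_conj).symm hSEfin hα' hβ'
    rw [hR]
    refine (hg.mono fun s hs => ?_).congr fun s hs => (hgL s hs).symm
    simp only [Set.mem_setOf_eq] at hs ⊢
    constructor
    · intro h; rw [h, Complex.zero_re] at hs; linarith
    · intro h; rw [h, Complex.one_re] at hs; linarith
  · -- the pole (Jacquet–Shalika (2.3))
    obtain ⟨r, hr, hT⟩ := (hJS μ) hN P P.conj (P.conj_conj).symm hSEfin hα' hβ'
    refine ⟨r, hr, ?_⟩
    rw [hR]
    exact hT

end RankinSelberg

/-! ### The dichotomy at every datum, and the fact from holomorphy, the `L²` facts and `hNV` -/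

section Reduction

open AdelicGroupData

variable {F E : Type} [Field F] [NumberField F] [Field E] [NumberField E] [Algebra F E]
  {N : ℕ} {hcpt : isCompact_glFiniteIntegralLevel N E}

/-- **Datum-independence of the sign, abstractly** (the bookkeeping of
`Mok2014_partialAsaiL_continuation_pole_dichotomy_of_holomorphy`, isolated): if every Asai datum
`(S, A)` of `π` satisfies the body of the fact with SOME sign `θ(S, A)`, then one sign serves for
all data — compare `(S, A)`, `(S₀, A₀)` through `(S ∪ S₀, A)` and `(S ∪ S₀, A₀)`
(`sign_eq_of_continuations_subset`; `A = A₀` above the complement of `S ∪ S₀` by the uniqueness of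
Satake parameters, `AutomorphicRepData.hasSatakeParamAt_unique_holds`). [folklore] -/
theorem AutomorphicRepData.exists_sign_forall_of_forall_exists_sign
    {π : AutomorphicRepData (AutomorphyDatum.gl N E hcpt)} {c : E ≃ₐ[F] E}
    (datum : ∀ (S : Set (HeightOneSpectrum (𝓞 F))) (A : SatakeFamily E), π.IsAsaiDatum c S A →
      ∃ (θ : ℤˣ) (σ₀ : ℝ), 1 ≤ σ₀ ∧
        (∀ (θ' : ℤˣ) (s : ℂ), σ₀ < s.re →
          Multipliable fun v : {v : HeightOneSpectrum (𝓞 F) // v ∉ S} =>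
            ((asaiLocalPolynomial c A θ' (placeAbove E v.1)).eval
              ((v.1.residueCard : ℂ) ^ (-s)))⁻¹) ∧
        (∃ G : ℂ → ℂ, DifferentiableOn ℂ G {s : ℂ | 1 / 2 < s.re} ∧
          (∀ s : ℂ, σ₀ < s.re → G s = (s - 1) * partialAsaiL S c A θ s) ∧ G 1 ≠ 0) ∧
        (∃ H : ℂ → ℂ, DifferentiableOn ℂ H {s : ℂ | 1 / 2 < s.re} ∧
          (∀ s : ℂ, σ₀ < s.re → H s = partialAsaiL S c A (-θ) s) ∧ H 1 ≠ 0)) :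
    ∃ η : ℤˣ, ∀ (S : Set (HeightOneSpectrum (𝓞 F))) (A : SatakeFamily E), π.IsAsaiDatum c S A →
      ∃ σ₀ : ℝ, 1 ≤ σ₀ ∧
        (∀ (θ : ℤˣ) (s : ℂ), σ₀ < s.re →
          Multipliable fun v : {v : HeightOneSpectrum (𝓞 F) // v ∉ S} =>
            ((asaiLocalPolynomial c A θ (placeAbove E v.1)).eval
              ((v.1.residueCard : ℂ) ^ (-s)))⁻¹) ∧
        (∃ G : ℂ → ℂ, DifferentiableOn ℂ G {s : ℂ | 1 / 2 < s.re} ∧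
          (∀ s : ℂ, σ₀ < s.re → G s = (s - 1) * partialAsaiL S c A η s) ∧ G 1 ≠ 0) ∧
        (∃ H : ℂ → ℂ, DifferentiableOn ℂ H {s : ℂ | 1 / 2 < s.re} ∧
          (∀ s : ℂ, σ₀ < s.re → H s = partialAsaiL S c A (-η) s) ∧ H 1 ≠ 0) := by
  classical
  by_cases hex : ∃ (S₀ : Set (HeightOneSpectrum (𝓞 F))) (A₀ : SatakeFamily E), π.IsAsaiDatum c S₀ A₀
  swap
  · exact ⟨1, fun S A hSA => absurd ⟨S, A, hSA⟩ hex⟩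
  obtain ⟨S₀, A₀, h₀⟩ := hex
  obtain ⟨θ₀, σ₀₀, -, -, -, hH₀⟩ := datum S₀ A₀ h₀
  refine ⟨θ₀, fun S A hSA => ?_⟩
  obtain ⟨θ, σ₀, hσ₀, hmul, hP, hH⟩ := datum S A hSA
  suffices hθ : θ = θ₀ by
    subst hθ
    exact ⟨σ₀, hσ₀, hmul, hP, hH⟩
  have hTfin : (S ∪ S₀).Finite := hSA.finite.union h₀.finite
  have hT : π.IsAsaiDatum c (S ∪ S₀) A := hSA.mono Set.subset_union_left hTfin
  have hT₀ : π.IsAsaiDatum c (S ∪ S₀) A₀ := h₀.mono Set.subset_union_right hTfin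
  obtain ⟨θT, σT, hσT, hmulT, hPT, hHT⟩ := datum (S ∪ S₀) A hT
  obtain ⟨θT₀, σT₀, hσT₀, hmulT₀, hPT₀, -⟩ := datum (S ∪ S₀) A₀ hT₀
  have hAA₀ : partialAsaiL (S ∪ S₀) c A = partialAsaiL (S ∪ S₀) c A₀ :=
    partialAsaiL_congr (S ∪ S₀) c fun w hw =>
      π.hasSatakeParamAt_unique_holds (hSA.hasSatakeParamAt fun h => hw (Or.inl h))
        (h₀.hasSatakeParamAt fun h => hw (Or.inr h))
  have hdiff : ((S ∪ S₀) \ S).Finite := hTfin.subset fun _ hv => hv.1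
  have hdiff₀ : ((S ∪ S₀) \ S₀).Finite := hTfin.subset fun _ hv => hv.1
  have hdiffT : ((S ∪ S₀) \ (S ∪ S₀)).Finite := hTfin.subset fun _ hv => hv.1
  obtain ⟨H, hH', hHL, -⟩ := hH
  obtain ⟨H₀, hH₀', hH₀L, -⟩ := hH₀
  obtain ⟨HT, hHT', hHTL, -⟩ := hHT
  have e₁ : θ = θT :=
    sign_eq_of_continuations_subset Set.subset_union_left hdiff c A hmulT ⟨σT, hσT, hPT⟩
      ⟨σ₀, H, hH', hHL⟩
  have e₂ : θ₀ = θT₀ :=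
    sign_eq_of_continuations_subset Set.subset_union_right hdiff₀ c A₀ hmulT₀ ⟨σT₀, hσT₀, hPT₀⟩
      ⟨σ₀₀, H₀, hH₀', hH₀L⟩
  have hPT₀' : ∃ G : ℂ → ℂ, DifferentiableOn ℂ G {s : ℂ | 1 / 2 < s.re} ∧
      (∀ s : ℂ, σT₀ < s.re → G s = (s - 1) * partialAsaiL (S ∪ S₀) c A θT₀ s) ∧ G 1 ≠ 0 := by
    rw [hAA₀]
    exact hPT₀
  have e₃ : θT = θT₀ :=
    sign_eq_of_continuations_subset (Set.Subset.refl (S ∪ S₀)) hdiffT c A hmulT ⟨σT₀, hσT₀, hPT₀'⟩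
      ⟨σT, HT, hHT', hHTL⟩
  rw [e₁, e₃, ← e₂]

/-- **Mok's Asai-pole dichotomy in continuation form, from holomorphy (Grbac–Shahidi, Thm. 4.3
(2)(a)), the `L²` Rankin–Selberg facts (Mœglin–Waldspurger, Jacquet–Shalika) and the absence of
poles of the unramified Asai factors at `s = 1` (Jacquet–Shalika's local bound).**

* `hHol` — as in `Mok2014_partialAsaiL_continuation_pole_dichotomy_of_holomorphy`: for a conjugate
  self-dual cuspidal `Π`, every Asai datum and sign, `(s - 1) L^S(s, Π, As^η)` continues
  holomorphically to `{1/2 < Re s}` (Grbac–Shahidi 2015, Thm. 4.3 (2)(a), holomorphy part).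
* `hMW`, `hJS` — the tree's named facts `MoeglinWaldspurger1989_partialPairL_of_eq_conj`
  (`s (s - 1) L^S(s, π ⊗ π̄)` entire) and `JacquetShalika1981_partialPairL_pole_of_eq_conj` (simple
  pole of `L^S(s, π ⊗ π̄)` at `1` along `Re s → 1⁺`), over `E`, in rank `N`, for every automorphic
  measure.
* `hNV` — for a conjugate self-dual cuspidal `Π`, an Asai datum `(S, A)`, a sign `θ` and an
  unramified `v ∉ S`: `det(1 - As^θ(t_v) q_v^{-1}) ≠ 0`, i.e. the unramified local factor
  `L(s, Π_v, As^θ)` has no pole at `s = 1` — in print the consequence of Jacquet–Shalika 1981 I,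
  Cor. 2.5 ("the eigenvalues of `A` are in absolute value `< q^{1/2}`", `q = q_w`): the eigenvalues
  `±α_i`, `α_i α_j` (inert `v`, `q_w = q_v²`; in `T = q_v^{-s}` the factor is
  `∏ (1 - θ α_i T) ∏_{i<j} (1 - α_i α_j T²)`) and `α_i β_j` (split `v`) are then `< q_v` resp. `< q_v²`
  in absolute value. (In the tree: the local fact `JacquetShalika1981_norm_lt_sqrt_of_isGeneric` plus
  the local–global dictionary for EVERY unramified component; kept as a hypothesis.)

Proof. For `Π` fixed take `S⋆` from `exists_largeSet_pairL_of_L2`. At a LARGE datum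
(`S⋆ ⊆ S`) the order count `exists_sign_partialAsaiL_of_continuations` applies verbatim (clause (i) by
`exists_multipliable_asaiEulerFactors`). At an arbitrary datum `(S, A)` it is applied to
`(S ∪ S⋆, A)` and transported down: the pole by `apply_one_ne_zero_of_subset`, holomorphy and
non-vanishing at `1` by `exists_continuation_of_subset_of_ne_zero` and `hNV`. The sign is then
independent of the datum (`exists_sign_forall_of_forall_exists_sign`).
[cite: GrbacShahidi2015, Thm. 4.3 (2) and its proof, pp. 204–206]
[cite: Mok2014, §2.5 (paragraph before Thm. 2.5.4) and Thm. 2.5.4 (a)]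
[cite: MoeglinWaldspurger1989, Appendice, Corollaire (ii)] [cite: ArthurClozelAMS120, Ch. 3 §2 (2.3)]
[cite: JacquetShalikaAJM1981, Cor. 2.5] -/
theorem Mok2014_partialAsaiL_continuation_pole_dichotomy_of_holomorphy_of_L2
    (hHol : ∀ (F E : Type) [Field F] [NumberField F] [Field E] [NumberField E] [Algebra F E]
      (c : E ≃ₐ[F] E), Module.finrank F E = 2 → c ≠ 1 →
      ∀ (N : ℕ) (hcpt : isCompact_glFiniteIntegralLevel N E)
        (π : CuspidalAutomorphicRepData N E hcpt), 0 < N → π.1.IsConjSelfDualAE c →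
        ∀ (S : Set (HeightOneSpectrum (𝓞 F))) (A : SatakeFamily E) (η : ℤˣ),
          π.1.IsAsaiDatum c S A →
          ∃ σ₀ : ℝ, 1 ≤ σ₀ ∧ ∃ G : ℂ → ℂ, DifferentiableOn ℂ G {s : ℂ | 1 / 2 < s.re} ∧
            ∀ s : ℂ, σ₀ < s.re → G s = (s - 1) * partialAsaiL S c A η s)
    (hMW : ∀ (E : Type) [Field E] [NumberField E] (N : ℕ)
      (μ : Measure (gl N E).automorphicQuotient) [(gl N E).IsAutomorphicMeasure μ],
      MoeglinWaldspurger1989_partialPairL_of_eq_conj (n := N) (K := E) (μ := μ))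
    (hJS : ∀ (E : Type) [Field E] [NumberField E] (N : ℕ)
      (μ : Measure (gl N E).automorphicQuotient) [(gl N E).IsAutomorphicMeasure μ],
      JacquetShalika1981_partialPairL_pole_of_eq_conj (n := N) (K := E) (μ := μ))
    (hNV : ∀ (F E : Type) [Field F] [NumberField F] [Field E] [NumberField E] [Algebra F E]
      (c : E ≃ₐ[F] E), Module.finrank F E = 2 → c ≠ 1 →
      ∀ (N : ℕ) (hcpt : isCompact_glFiniteIntegralLevel N E)
        (π : CuspidalAutomorphicRepData N E hcpt), 0 < N → π.1.IsConjSelfDualAE c →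
        ∀ (S : Set (HeightOneSpectrum (𝓞 F))) (A : SatakeFamily E) (θ : ℤˣ),
          π.1.IsAsaiDatum c S A → ∀ v : HeightOneSpectrum (𝓞 F), v ∉ S →
            (asaiLocalPolynomial c A θ (placeAbove E v)).eval
              ((v.residueCard : ℂ) ^ (-(1 : ℂ))) ≠ 0) :
    Mok2014_partialAsaiL_continuation_pole_dichotomy := by
  intro F E _ _ _ _ _ c h2 hc N hcpt π hN hπ
  classical
  obtain ⟨Sstar, hSstar, hlarge⟩ :=
    π.exists_largeSet_pairL_of_L2 (hMW E N) (hJS E N) hN hπ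
  -- the dichotomy at a LARGE datum, with the continuations on its own half-plane
  have large : ∀ (S : Set (HeightOneSpectrum (𝓞 F))) (A : SatakeFamily E), Sstar ⊆ S →
      π.1.IsAsaiDatum c S A →
      ∃ (θ : ℤˣ) (σ : ℝ), 1 ≤ σ ∧
        (∃ G : ℂ → ℂ, DifferentiableOn ℂ G {s : ℂ | 1 / 2 < s.re} ∧
          (∀ s : ℂ, σ < s.re → G s = (s - 1) * partialAsaiL S c A θ s) ∧ G 1 ≠ 0) ∧
        (∃ H : ℂ → ℂ, DifferentiableOn ℂ H {s : ℂ | 1 / 2 < s.re} ∧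
          (∀ s : ℂ, σ < s.re → H s = partialAsaiL S c A (-θ) s) ∧ H 1 ≠ 0) := by
    intro S A hSS hSA
    obtain ⟨σ₁, hσ₁, hmulA⟩ := π.exists_multipliable_asaiEulerFactors h2 hN hSA
    obtain ⟨σp, -, Gp, hGp, hGLp⟩ := hHol F E c h2 hc N hcpt π hN hπ S A 1 hSA
    obtain ⟨σn, -, Gn, hGn, hGLn⟩ := hHol F E c h2 hc N hcpt π hN hπ S A (-1) hSA
    obtain ⟨⟨σR, hmulP⟩, hRhol, r, hr, hpole⟩ := hlarge S A hSS hSA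
    set σ : ℝ := max (max σ₁ σR) (max σp σn) with hσdef
    have hσ₁σ : σ₁ ≤ σ := (le_max_left _ _).trans (le_max_left _ _)
    have hσRσ : σR ≤ σ := (le_max_right _ _).trans (le_max_left _ _)
    have hσ : 1 ≤ σ := hσ₁.trans hσ₁σ
    have hσpσ : σp ≤ σ := (le_max_left _ _).trans (le_max_right _ _)
    have hσnσ : σn ≤ σ := (le_max_right _ _).trans (le_max_right _ _)
    have hinert : ∀ w : HeightOneSpectrum (𝓞 E), w.under (𝓞 F) ∉ S → c • w = w →
        w.asIdeal.inertiaDeg (𝓞 F) = 2 := fun w hw hcw => hSA.inertiaDeg_eq_two hw hcw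
    obtain ⟨θ, hP, hH⟩ := exists_sign_partialAsaiL_of_continuations h2 hc hinert hσ
      (fun θ s hs => hmulA θ s (lt_of_le_of_lt hσ₁σ hs))
      (fun s hs => hmulP s (lt_of_le_of_lt hσRσ hs)) hRhol hr hpole hGp hGn
      (fun s hs => hGLp s (lt_of_le_of_lt hσpσ hs)) (fun s hs => hGLn s (lt_of_le_of_lt hσnσ hs))
    exact ⟨θ, σ, hσ, hP, hH⟩
  -- the dichotomy at EVERY datum, transported down from `(S ∪ S⋆, A)`
  refine AutomorphicRepData.exists_sign_forall_of_forall_exists_sign fun S A hSA => ?_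
  have hS''fin : (S ∪ Sstar).Finite := hSA.finite.union hSstar
  have hSA'' : π.1.IsAsaiDatum c (S ∪ Sstar) A := hSA.mono Set.subset_union_left hS''fin
  have hdiff : ((S ∪ Sstar) \ S).Finite := hS''fin.subset fun _ hv => hv.1
  obtain ⟨θ, σ'', hσ'', ⟨G'', hG'', hG''L, hG''1⟩, ⟨H'', hH'', hH''L, hH''1⟩⟩ :=
    large (S ∪ Sstar) A Set.subset_union_right hSA''
  -- data at `S`: clause (i), the two continuations of `hHol`
  obtain ⟨σ₁, hσ₁, hmulA⟩ := π.exists_multipliable_asaiEulerFactors h2 hN hSA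
  obtain ⟨σm, -, hmulA''⟩ := π.exists_multipliable_asaiEulerFactors h2 hN hSA''
  obtain ⟨σp, hσp, Gp, hGp, hGLp⟩ := hHol F E c h2 hc N hcpt π hN hπ S A θ hSA
  obtain ⟨σn, hσn, Gn, hGn, hGLn⟩ := hHol F E c h2 hc N hcpt π hN hπ S A (-θ) hSA
  -- the pole goes down
  have hGp1 : Gp 1 ≠ 0 :=
    apply_one_ne_zero_of_subset Set.subset_union_left hdiff c A θ (hmulA'' θ) hσp hGp hGLp hG''
      hG''L hG''1
  -- holomorphy and non-vanishing at `1` go down, by `hNV`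
  have hNV' : ∀ v ∈ hdiff.toFinset,
      (asaiLocalPolynomial c A (-θ) (placeAbove E v)).eval ((v.residueCard : ℂ) ^ (-(1 : ℂ))) ≠ 0 :=
    fun v hv => hNV F E c h2 hc N hcpt π hN hπ S A (-θ) hSA v (hdiff.mem_toFinset.mp hv).2
  obtain ⟨H, hH, hHL, hH1⟩ := exists_continuation_of_subset_of_ne_zero Set.subset_union_left hdiff
    c A (-θ) (hmulA'' (-θ)) hσn hGn hGLn hH'' hH''L hH''1 hNV'
  -- package on the common half-plane `{σ < Re s}`
  set σ : ℝ := max σ₁ (max σp σn) with hσdef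
  have hσ₁σ : σ₁ ≤ σ := le_max_left _ _
  have hσpσ : σp ≤ σ := (le_max_left _ _).trans (le_max_right _ _)
  have hσnσ : σn ≤ σ := (le_max_right _ _).trans (le_max_right _ _)
  exact ⟨θ, σ, hσ₁.trans hσ₁σ, fun θ' s hs => hmulA θ' s (lt_of_le_of_lt hσ₁σ hs),
    ⟨Gp, hGp, fun s hs => hGLp s (lt_of_le_of_lt hσpσ hs), hGp1⟩,
    ⟨H, hH, fun s hs => hHL s (lt_of_le_of_lt hσnσ hs), hH1⟩⟩

end Reduction

end Literature.NumberTheory.Automorphic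

end
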